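import Summits.Ventures.HSemireg.WedgeHankelRecurrenceGaussExtremal

/-!
# Venture HSemireg — **THE GAUSS–RADAU RULE**: from the `(t+1)`-point Gauss rule `(ν, w)` of `(x − c)·σ` (exact in degree `≤ 2t + 1`) the `(t+2)`-point rule with the PRESCRIBED node `c`,
# nodes `c, w_0, …, w_t` and weights `λ_c = σ(1) − Σ λ_l`, `λ_l = ν_l/(w_l − c)`, is exact for `σ` in degree `≤ 2t + 2`; for a positive discrete `σ` with `≥ t + 2` nodes all `> c` every
# weight is positive (`λ_l` by Christoffel N265 + N264, `λ_c = σ(∏(x − w_l)²)/∏(c − w_l)²` by exactness at degree `2t + 2`)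

HONEST FRAMING. Part of the Lean index of the computation cell `pub-hsemireg` (seat p10 gen 42, Sunday typer «UNIFORM-IN-n»).  Real polynomials and finite sums only, on top of N262 ∕ N264 ∕
N265 ∕ N268; no variety, no cohomology theory, no sheaf, no Ext group and no semiregularity map is constructed here; nothing here says that HC / HC_CM / HC_AV holds; no Literature fact
(unproved `Prop`) is declared or used.  Custodian versions as in `WedgeHankelSiegelIdeal` (1/3).
SOURCES (cited).  R. Radau, *Étude sur les formules d'approximation qui servent à calculer la valeur numérique d'une intégrale définie*, J. Math. Pures Appl. (3) 6 (1880) 283–336; G. Szegő,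
*Orthogonal Polynomials*, §3.4 (mechanical quadrature) with Thm 2.5 (orthogonal polynomials of `(x − c) dα`); W. Gautschi, *A survey of Gauss–Christoffel quadrature formulae*, in:
*E. B. Christoffel* (Birkhäuser, 1981), §2.2.1 (Gauss–Radau: `n + 1` nodes one of which is a prescribed endpoint, degree of exactness `2n`); M. G. Krein, A. A. Nudel'man, *The Markov Moment
Problem and Extremal Problems* (1977), Ch. III §3 (upper principal representation with an endpoint node).
PROOF TYPED HERE.  With `F(p) = Σ M V^p − Σ λ_l w_l^p − λ_c c^p`: `F(0) = 0` by the choice of `λ_c`, and `F(p+1) = c F(p)` for `p ≤ 2t + 1` because `Σ M V^{p+1} = Σ ν w^p + c Σ M V^p` and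
`Σ λ w^{p+1} = Σ ν w^p + c Σ λ w^p`.  Positivity of `λ_c`: test `∏_l (X − w_l)²` (degree `2t + 2`).
DEDUP DISCLOSURE (`rg -n 'Radau|radau' Summits/Ventures/HSemireg Literature`, 2026-09-02): nothing.  The 5 names below: 0 hits tree-wide.

WHAT IS IN THE TREE.  N262 `sum_mul_eval_eq_of_moments_eq`; N264 `exists_node_le_gaussNode_zero`; N265 `gauss_weight_pos`; N268 `exists_node_ne_of_lt_card`; Mathlib `Fin.sum_univ_succ`,
`Fin.cons_zero`, `Fin.cons_succ`.
THIS FILE (namespace `Summit.Ventures.HSemireg.Wedge.HankelOuter` continued; CHAINED on N275 (import) and N268; 0 definitions):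
* §1041 **`gauss_radau_exact`** (exactness in degree `≤ 2t + 2`, split form), `gauss_radau_exact_cons` (the `(t+2)`-point rule as `Fin.cons` families), `gauss_radau_nodes_gt` (`c < w_l` and
  `ν_l > 0`, hence `λ_l > 0`, for a positive measure right of `c`), **`gauss_radau_weight_fixed_pos`** (`λ_c > 0`), **`gauss_radau`** (packaged: exact in degree `≤ 2t + 2`, all weights positive).
CAVEATS.  Discrete integrating measure only; nothing Ext-side.  New names only.
-/

open Module Polynomial
open scoped Matrix Polynomial

namespace Summit.Ventures.HSemireg.Wedge.HankelOuter

/-! ## §1041. Gauss–Radau -/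

/-- **GAUSS–RADAU EXACTNESS**: if `Σ_l ν_l w_l^p = Σ_l M_l (V_l − c) V_l^p` for `p ≤ 2t + 1` (`w_l ≠ c`), then with `λ_l = ν_l/(w_l − c)` and `λ_c = Σ M_l − Σ λ_l`:
`λ_c c^p + Σ_l λ_l w_l^p = Σ_l M_l V_l^p` for every `p ≤ 2t + 2`. [Radau 1880; Gautschi 1981 §2.2.1; this file, §1041] -/
theorem gauss_radau_exact {t P : ℕ} {ν w : Fin (t + 1) → ℝ} {M V : Fin P → ℝ} {c : ℝ}
    (hB : ∀ p, p ≤ 2 * t + 1 → ∑ l, ν l * w l ^ p = ∑ l, (M l * (V l - c)) * V l ^ p) (hwc : ∀ l, w l ≠ c) {p : ℕ} (hp : p ≤ 2 * t + 2) :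
    (∑ l, M l - ∑ l, ν l / (w l - c)) * c ^ p + ∑ l, (ν l / (w l - c)) * w l ^ p = ∑ l, M l * V l ^ p := by
  induction p with
  | zero => simp only [pow_zero, mul_one]; ring
  | succ p ih =>
    have ih' := ih (by omega)
    have h1 : ∑ l, M l * V l ^ (p + 1) = ∑ l, ν l * w l ^ p + c * ∑ l, M l * V l ^ p := by
      rw [hB p (by omega), Finset.mul_sum, ← Finset.sum_add_distrib]
      exact Finset.sum_congr rfl fun l _ => by rw [pow_succ]; ring
    have h2 : ∑ l, (ν l / (w l - c)) * w l ^ (p + 1) = ∑ l, ν l * w l ^ p + c * ∑ l, (ν l / (w l - c)) * w l ^ p := by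
      rw [Finset.mul_sum, ← Finset.sum_add_distrib]
      refine Finset.sum_congr rfl fun l _ => ?_
      have hne : w l - c ≠ 0 := sub_ne_zero.2 (hwc l)
      rw [pow_succ]
      field_simp
      ring
    rw [h1, h2, ← ih', pow_succ]
    ring

/-- **The Radau rule as a `(t+2)`-point family** (`Fin.cons`): node `c` first, then `w_0, …, w_t`; exact in degree `≤ 2t + 2`. [Radau 1880; this file, §1041] -/
theorem gauss_radau_exact_cons {t P : ℕ} {ν w : Fin (t + 1) → ℝ} {M V : Fin P → ℝ} {c : ℝ}
    (hB : ∀ p, p ≤ 2 * t + 1 → ∑ l, ν l * w l ^ p = ∑ l, (M l * (V l - c)) * V l ^ p) (hwc : ∀ l, w l ≠ c) {p : ℕ} (hp : p ≤ 2 * t + 2) :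
    ∑ i : Fin (t + 2), (Fin.cons (∑ l, M l - ∑ l, ν l / (w l - c)) (fun l => ν l / (w l - c)) : Fin (t + 2) → ℝ) i * (Fin.cons c w : Fin (t + 2) → ℝ) i ^ p
      = ∑ l, M l * V l ^ p := by
  rw [Fin.sum_univ_succ]
  simp only [Fin.cons_zero, Fin.cons_succ]
  exact gauss_radau_exact hB hwc hp

/-- **For a positive measure right of `c` the Gauss nodes of `(x − c)σ` exceed `c` and its weights are positive** (so every `λ_l = ν_l/(w_l − c) > 0`).
[N265 + N264; this file, §1041] -/
theorem gauss_radau_nodes_gt {t P : ℕ} {ν w : Fin (t + 1) → ℝ} {M V : Fin P → ℝ} {c : ℝ} (hM : ∀ l, 0 < M l) (hV : Function.Injective V) (hP : t + 1 ≤ P) (hcV : ∀ l, c < V l)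
    (hw : StrictMono w) (hB : ∀ p, p ≤ 2 * t + 1 → ∑ l, ν l * w l ^ p = ∑ l, (M l * (V l - c)) * V l ^ p) :
    (∀ l, 0 < ν l) ∧ (∀ l, c < w l) ∧ ∀ l, 0 < ν l / (w l - c) := by
  have hMc : ∀ l, 0 < M l * (V l - c) := fun l => mul_pos (hM l) (sub_pos.2 (hcV l))
  have hν : ∀ l, 0 < ν l := gauss_weight_pos (ν := fun l => M l * (V l - c)) hw.injective hMc hV hP (fun p hp => hB p (by omega))
  obtain ⟨l₀, hl₀⟩ := exists_node_le_gaussNode_zero (ν := fun l => M l * (V l - c)) hν hw hMc hB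
  have hcw : ∀ l, c < w l := fun l => lt_of_lt_of_le (lt_of_lt_of_le (hcV l₀) hl₀) (hw.monotone (Fin.zero_le l))
  exact ⟨hν, hcw, fun l => div_pos (hν l) (sub_pos.2 (hcw l))⟩

/-- **The weight at the prescribed node is positive**: `λ_c = Σ M − Σ ν_l/(w_l − c) > 0` for a positive measure with at least `t + 2` distinct nodes, all `> c`
(test polynomial `∏_l (X − w_l)²`, degree `2t + 2`). [Gautschi 1981 §2.2.1; Krein–Nudel'man III §3; this file, §1041] -/
theorem gauss_radau_weight_fixed_pos {t P : ℕ} {ν w : Fin (t + 1) → ℝ} {M V : Fin P → ℝ} {c : ℝ} (hM : ∀ l, 0 < M l) (hV : Function.Injective V) (hP : t + 2 ≤ P)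
    (hcV : ∀ l, c < V l) (hw : StrictMono w) (hB : ∀ p, p ≤ 2 * t + 1 → ∑ l, ν l * w l ^ p = ∑ l, (M l * (V l - c)) * V l ^ p) :
    0 < ∑ l, M l - ∑ l, ν l / (w l - c) := by
  obtain ⟨-, hcw, -⟩ := gauss_radau_nodes_gt hM hV (by omega) hcV hw hB
  have hwc : ∀ l, w l ≠ c := fun l => (hcw l).ne'
  set lc := ∑ l, M l - ∑ l, ν l / (w l - c) with hlc
  set F : ℝ[X] := ∏ l, (Polynomial.X - C (w l)) ^ 2 with hF
  have hFdeg : F.natDegree < 2 * t + 3 := by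
    rw [hF, natDegree_prod_of_monic _ _ fun l _ => (monic_X_sub_C (w l)).pow 2]
    simp only [(monic_X_sub_C _).natDegree_pow, natDegree_X_sub_C, Finset.sum_const, Finset.card_univ, Fintype.card_fin, smul_eq_mul]
    omega
  have hq := sum_mul_eval_eq_of_moments_eq (N := 2 * t + 3) (fun p hp => gauss_radau_exact_cons hB hwc (p := p) (by omega)) hFdeg
  rw [Fin.sum_univ_succ] at hq
  simp only [Fin.cons_zero, Fin.cons_succ] at hq
  -- `F` vanishes on the `w_l`
  have hz : ∑ l : Fin (t + 1), ν l / (w l - c) * F.eval (w l) = 0 := Finset.sum_eq_zero fun l _ => by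
    have : F.eval (w l) = 0 := by
      rw [hF, eval_prod]; exact Finset.prod_eq_zero (Finset.mem_univ l) (by rw [eval_pow, eval_sub, eval_X, eval_C, sub_self, zero_pow two_ne_zero])
    rw [this, mul_zero]
  rw [hz, add_zero] at hq
  -- the right-hand side is positive
  obtain ⟨l₁, hl₁⟩ := exists_node_ne_of_lt_card (v := w) hV (by omega)
  have hpos : 0 < ∑ l, M l * F.eval (V l) := by
    have hnn : ∀ l ∈ (Finset.univ : Finset (Fin P)), 0 ≤ M l * F.eval (V l) := fun l _ =>
      mul_nonneg (hM l).le (by rw [hF, eval_prod]; exact Finset.prod_nonneg fun j _ => by rw [eval_pow]; exact sq_nonneg _)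
    refine lt_of_lt_of_le (mul_pos (hM l₁) ?_) (Finset.single_le_sum hnn (Finset.mem_univ l₁))
    rw [hF, eval_prod]
    refine Finset.prod_pos fun j _ => ?_
    have hne : V l₁ - w j ≠ 0 := sub_ne_zero.2 (hl₁ j)
    rw [eval_pow, eval_sub, eval_X, eval_C]
    positivity
  have hFc : 0 < F.eval c := by
    rw [hF, eval_prod]
    refine Finset.prod_pos fun j _ => ?_
    have hne : c - w j ≠ 0 := sub_ne_zero.2 (hwc j).symm
    rw [eval_pow, eval_sub, eval_X, eval_C]
    positivity
  by_contra hle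
  rw [not_lt] at hle
  have : lc * F.eval c ≤ 0 := mul_nonpos_iff.2 (Or.inr ⟨hle, hFc.le⟩)
  linarith

/-- **THE GAUSS–RADAU RULE (packaged)**: for a positive discrete measure `(M, V)` with at least `t + 2` distinct nodes all `> c`, and `(ν, w)` the `(t+1)`-point Gauss rule of `(x − c)·(M, V)`
(strictly increasing nodes, exact in degree `≤ 2t + 1`), the rule with nodes `c, w_0, …, w_t` and weights `λ_c = Σ M − Σ λ_l`, `λ_l = ν_l/(w_l − c)` is exact for `(M, V)` in degree
`≤ 2t + 2`, all its weights are positive and `c < w_0`. [Radau 1880; Gautschi 1981 §2.2.1; Krein–Nudel'man III §3; this file, §1041] -/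
theorem gauss_radau {t P : ℕ} {ν w : Fin (t + 1) → ℝ} {M V : Fin P → ℝ} {c : ℝ} (hM : ∀ l, 0 < M l) (hV : Function.Injective V) (hP : t + 2 ≤ P) (hcV : ∀ l, c < V l)
    (hw : StrictMono w) (hB : ∀ p, p ≤ 2 * t + 1 → ∑ l, ν l * w l ^ p = ∑ l, (M l * (V l - c)) * V l ^ p) :
    (∀ p, p ≤ 2 * t + 2 → (∑ l, M l - ∑ l, ν l / (w l - c)) * c ^ p + ∑ l, (ν l / (w l - c)) * w l ^ p = ∑ l, M l * V l ^ p) ∧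
      0 < ∑ l, M l - ∑ l, ν l / (w l - c) ∧ (∀ l, 0 < ν l / (w l - c)) ∧ ∀ l, c < w l := by
  obtain ⟨-, hcw, hlam⟩ := gauss_radau_nodes_gt hM hV (by omega) hcV hw hB
  exact ⟨fun p hp => gauss_radau_exact hB (fun l => (hcw l).ne') hp, gauss_radau_weight_fixed_pos hM hV hP hcV hw hB, hlam, hcw⟩

end Summit.Ventures.HSemireg.Wedge.HankelOuter
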